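import Mathlib
import Literature.Computability.AlgebraicComplexity.StandardFamilies
import Summits.ValiantsHypothesis.ValiantsHypothesis.Theorems.ElementaryWordLengthWordLengthQPRungOne

/-!
# Crux `WordLengthQP` (stmt-ValiantsHypothesis-6623), line `Sketch` (eps-order-ladder) —
rung `q = 1`: the ONE-WALK QUADRATIC NORMAL FORM for invertible skeletons

What distinguishes an order-one border width-2 program from a mere sum of exact width-2
programs (`rungOne_sumW2_of_orderOne`, whose hardness is `ΣΠΣ`-hard by `sumW2_of_sigmaPiSigma`)
is that all its terms share ONE exact skeleton `A₁ ⋯ A_L` with `(∏ A)₀₀ = 0`.  This file makes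
that constraint explicit in the INVERTIBLE-SKELETON case (every `A_t = m_t|_{ε=0}` has a non-zero
constant determinant — Allender–Wang's "inherently non-degenerate" letters):

`rungOne_oneWalk_normal_form`:  with `P := ∏ A`, `P₀₀ = 0` and `det P ∈ ℂˣ` force `P₁₀ ∈ ℂˣ`, and
for every position `t`

  `(A₁⋯A_{t-1} · B_t · A_{t+1}⋯A_L)₀₀ = κ_t · ( p_t² N₀₁ − q_t² N₁₀ + p_t q_t (N₁₁ − N₀₀) )`,

where `(p_t, q_t)` is row `0` of the PREFIX `U_t = A₁ ⋯ A_{t-1}` — the row-walk of ONE word —,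
`N = B_t · adj(A_t)` (entries of degree `≤ 2`) and `κ_t = P₁₀ / (det U_t · det A_t) ∈ ℂˣ`.
Hence (`rungOne_normal_form`, p119541) an order-one program of length `L` with invertible
skeleton writes `f` as a sum of `L` binary QUADRATIC forms with low-degree coefficients evaluated
along the prefix rows of a single S-affine word: squares of continuant pairs.  This "one walk" is
exactly what the `Σ W2` relaxation forgets, and is the handle for a degree-control /
partial-derivative attack on rung 1 (line card `Lines/Sketch.md`, v4).
-/

-- `Summit.ValiantsHypothesis.ValiantsHypothesis.…` is the tree's mandated single-conjunct layout
-- (Sub = Summit), so the duplicated namespace component is intended.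
set_option linter.dupNamespace false

noncomputable section

open MvPolynomial

namespace Summit.ValiantsHypothesis.ValiantsHypothesis.Cruxes.WordLengthQP.EpsOrderLadder

/-! ### Constants and determinants -/

/-- Over `ℂ[x̄]`, a factor of a non-zero constant is a non-zero constant. [folklore] -/
theorem oneWalk_const_of_mul_eq_C {σ : Type} (a b : MvPolynomial σ ℂ) (c : ℂ) (hc : c ≠ 0)
    (h : a * b = MvPolynomial.C c) : ∃ α : ℂ, α ≠ 0 ∧ a = MvPolynomial.C α := by
  have hab : a * b ≠ 0 := by rw [h, Ne, MvPolynomial.C_eq_zero]; exact hc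
  have ha : a ≠ 0 := left_ne_zero_of_mul hab
  have hb : b ≠ 0 := right_ne_zero_of_mul hab
  have hdeg : a.totalDegree = 0 := by
    have h1 : (a * b).totalDegree = 0 := by rw [h]; exact MvPolynomial.totalDegree_C c
    rw [MvPolynomial.totalDegree_mul_of_isDomain ha hb] at h1
    omega
  rw [MvPolynomial.totalDegree_eq_zero_iff_eq_C] at hdeg
  refine ⟨MvPolynomial.coeff 0 a, fun h0 => ha ?_, hdeg⟩
  rw [hdeg, h0, map_zero]

/-- The determinant of a product of constant-unit-determinant matrices is a constant unit.
[folklore] -/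
theorem oneWalk_det_list_prod {σ : Type}
    (As : List (Matrix (Fin 2) (Fin 2) (MvPolynomial σ ℂ)))
    (hdet : ∀ A ∈ As, ∃ d : ℂ, d ≠ 0 ∧ A.det = MvPolynomial.C d) :
    ∃ D : ℂ, D ≠ 0 ∧ As.prod.det = MvPolynomial.C D := by
  induction As with
  | nil => exact ⟨1, one_ne_zero, by simp⟩
  | cons A As ih =>
    obtain ⟨d, hd, hA⟩ := hdet A (by simp)
    obtain ⟨D, hD, hAs⟩ := ih (fun A' hA' => hdet A' (by simp [hA']))
    exact ⟨d * D, mul_ne_zero hd hD, by rw [List.prod_cons, Matrix.det_mul, hA, hAs, map_mul]⟩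

/-! ### The sandwich identity -/

/-- **Sandwich identity.**  If `U A V = P` with `det U = C d_U`, `det A = C d_A` non-zero
constants and `P₀₀ = 0`, then for every `B`
`(U B V)₀₀ = (d_U d_A)⁻¹ · P₁₀ · (U₀₀² N₀₁ − U₀₁² N₁₀ + U₀₀ U₀₁ (N₁₁ − N₀₀))`, `N = B · adj A`.
[folklore] -/
theorem oneWalk_sandwich {σ : Type} (U A V P B : Matrix (Fin 2) (Fin 2) (MvPolynomial σ ℂ))
    (hUAV : U * A * V = P) (dU dA : ℂ) (hU : U.det = MvPolynomial.C dU)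
    (hA : A.det = MvPolynomial.C dA) (hdU : dU ≠ 0) (hdA : dA ≠ 0) (hP : P 0 0 = 0) :
    (U * B * V) 0 0 = MvPolynomial.C ((dU * dA)⁻¹) * P 1 0 *
      (U 0 0 ^ 2 * (B * A.adjugate) 0 1 - U 0 1 ^ 2 * (B * A.adjugate) 1 0 +
        U 0 0 * U 0 1 * ((B * A.adjugate) 1 1 - (B * A.adjugate) 0 0)) := by
  -- `det (U A) • V = adj (U A) ⬝ P`
  have hV : (MvPolynomial.C (dU * dA) : MvPolynomial σ ℂ) • V = A.adjugate * U.adjugate * P := by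
    have h1 : (U * A).adjugate * (U * A) * V = (U * A).adjugate * P := by
      rw [Matrix.mul_assoc, hUAV]
    rw [Matrix.adjugate_mul, Matrix.det_mul, hU, hA, ← map_mul, Matrix.smul_mul, Matrix.one_mul,
      Matrix.adjugate_mul_distrib] at h1
    exact h1
  -- hence `C (dU dA) • (U B V) = U B adj A adj U P`
  have hUBV : (MvPolynomial.C (dU * dA) : MvPolynomial σ ℂ) • (U * B * V) =
      U * (B * A.adjugate) * U.adjugate * P := by
    rw [← Matrix.mul_smul, hV]
    simp only [Matrix.mul_assoc]
  have h00 := congrFun (congrFun hUBV 0) 0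
  rw [Matrix.smul_apply, smul_eq_mul] at h00
  -- divide by the constant
  have hinv : MvPolynomial.C ((dU * dA)⁻¹) * (MvPolynomial.C (dU * dA) : MvPolynomial σ ℂ) = 1 := by
    rw [← map_mul, inv_mul_cancel₀ (mul_ne_zero hdU hdA), map_one]
  have key : (U * B * V) 0 0 = MvPolynomial.C ((dU * dA)⁻¹) *
      ((U * (B * A.adjugate) * U.adjugate * P) 0 0) := by
    rw [← h00, ← mul_assoc, hinv, one_mul]
  rw [key, Matrix.mul_apply, Fin.sum_univ_two, hP, mul_zero, zero_add,
    Matrix.adjugate_fin_two A, Matrix.adjugate_fin_two U]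
  simp only [Matrix.mul_apply, Fin.sum_univ_two, Matrix.of_apply, Matrix.cons_val',
    Matrix.cons_val_zero, Matrix.cons_val_one, Matrix.cons_val_fin_one]
  ring

/-! ### Positions of one word -/

/-- Splitting a word at a position: `(take t) ⬝ A_t ⬝ (drop (t+1)) = ∏ A`. [folklore] -/
theorem oneWalk_split {M : Type} [Monoid M] (As : List M) (t : ℕ) (ht : t < As.length) :
    (As.take t).prod * As[t] * (As.drop (t + 1)).prod = As.prod := by
  conv_rhs => rw [← List.take_append_drop t As]
  rw [List.prod_append, List.drop_eq_getElem_cons ht, List.prod_cons, mul_assoc]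

/-- **One-walk quadratic normal form (invertible skeleton).**  Let a product of width-2 matrices
over `ℂ[ε][x̄]` with S-affine entries have `(0,0)` entry `ε · f + ε² · G`, and suppose every
`ε = 0` part `A_t` has a non-zero constant determinant.  Then, with `A_t`, the S-affine `B_t` of
`rungOne_normal_form`, the prefixes `U_t = A₁ ⋯ A_{t-1}` and `N_t = B_t · adj A_t`,

  `f = Σ_{t<L} κ_t · ( (U_t)₀₀² (N_t)₀₁ − (U_t)₀₁² (N_t)₁₀ + (U_t)₀₀ (U_t)₀₁ ((N_t)₁₁ − (N_t)₀₀) )`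

with non-zero constants `κ_t`: a sum of `L` binary quadratic forms evaluated along the prefix
row-walk `((U_t)₀₀, (U_t)₀₁)` of ONE S-affine word. -/
theorem rungOne_oneWalk_normal_form {σ : Type} (f : MvPolynomial σ ℂ)
    (ms : List (Matrix (Fin 2) (Fin 2) (MvPolynomial σ (Polynomial ℂ))))
    (hS : ∀ m ∈ ms, ∀ i j : Fin 2, (∃ b : Polynomial ℂ, m i j = MvPolynomial.C b) ∨
      (∃ (a b : Polynomial ℂ) (v : σ),
        m i j = MvPolynomial.C a * MvPolynomial.X v + MvPolynomial.C b))
    (hdet : ∀ m ∈ ms, ∃ d : ℂ, d ≠ 0 ∧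
      (m.map (MvPolynomial.map (Polynomial.evalRingHom 0))).det = MvPolynomial.C d)
    (G : MvPolynomial σ (Polynomial ℂ))
    (hF : ms.prod 0 0 = MvPolynomial.C Polynomial.X * MvPolynomial.map Polynomial.C f +
      MvPolynomial.C (Polynomial.X ^ 2) * G) :
    ∃ (Bs : List (Matrix (Fin 2) (Fin 2) (MvPolynomial σ ℂ))) (κ : ℕ → ℂ),
      Bs.length = ms.length ∧
      (∀ B ∈ Bs, ∀ i j : Fin 2, (∃ b : ℂ, B i j = MvPolynomial.C b) ∨
        (∃ (a b : ℂ) (v : σ), B i j = MvPolynomial.C a * MvPolynomial.X v + MvPolynomial.C b)) ∧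
      (∀ t < ms.length, κ t ≠ 0) ∧
      f = ∑ t ∈ Finset.range ms.length, MvPolynomial.C (κ t) *
        (((ms.map (fun m : Matrix (Fin 2) (Fin 2) (MvPolynomial σ (Polynomial ℂ)) =>
              m.map (MvPolynomial.map (Polynomial.evalRingHom 0)))).take t).prod 0 0 ^ 2 *
          (Bs.getD t 0 *
            ((ms.map (fun m : Matrix (Fin 2) (Fin 2) (MvPolynomial σ (Polynomial ℂ)) =>
              m.map (MvPolynomial.map (Polynomial.evalRingHom 0)))).getD t 0).adjugate) 0 1 -
          ((ms.map (fun m : Matrix (Fin 2) (Fin 2) (MvPolynomial σ (Polynomial ℂ)) =>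
              m.map (MvPolynomial.map (Polynomial.evalRingHom 0)))).take t).prod 0 1 ^ 2 *
          (Bs.getD t 0 *
            ((ms.map (fun m : Matrix (Fin 2) (Fin 2) (MvPolynomial σ (Polynomial ℂ)) =>
              m.map (MvPolynomial.map (Polynomial.evalRingHom 0)))).getD t 0).adjugate) 1 0 +
          ((ms.map (fun m : Matrix (Fin 2) (Fin 2) (MvPolynomial σ (Polynomial ℂ)) =>
              m.map (MvPolynomial.map (Polynomial.evalRingHom 0)))).take t).prod 0 0 *
          ((ms.map (fun m : Matrix (Fin 2) (Fin 2) (MvPolynomial σ (Polynomial ℂ)) =>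
              m.map (MvPolynomial.map (Polynomial.evalRingHom 0)))).take t).prod 0 1 *
          ((Bs.getD t 0 *
            ((ms.map (fun m : Matrix (Fin 2) (Fin 2) (MvPolynomial σ (Polynomial ℂ)) =>
              m.map (MvPolynomial.map (Polynomial.evalRingHom 0)))).getD t 0).adjugate) 1 1 -
            (Bs.getD t 0 *
            ((ms.map (fun m : Matrix (Fin 2) (Fin 2) (MvPolynomial σ (Polynomial ℂ)) =>
              m.map (MvPolynomial.map (Polynomial.evalRingHom 0)))).getD t 0).adjugate) 0 0)) := by
  obtain ⟨Bs, hBlen, hBS, hP00, hf⟩ := rungOne_normal_form f ms hS G hF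
  set As := ms.map (fun m => m.map (MvPolynomial.map (Polynomial.evalRingHom 0))) with hAs
  have hAlen : As.length = ms.length := by simp [hAs]
  have hAdet : ∀ A ∈ As, ∃ d : ℂ, d ≠ 0 ∧ A.det = MvPolynomial.C d := by
    intro A hA
    obtain ⟨m, hm, rfl⟩ := List.mem_map.1 hA
    exact hdet m hm
  -- the whole word `P = ∏ A`: `P₀₀ = 0`, `det P` a constant unit, hence `P₁₀` a constant unit
  obtain ⟨D, hD, hPdet⟩ := oneWalk_det_list_prod As hAdet
  have hP10 : ∃ π : ℂ, π ≠ 0 ∧ As.prod 1 0 = MvPolynomial.C π := by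
    refine oneWalk_const_of_mul_eq_C (As.prod 1 0) (As.prod 0 1) (-D) (neg_ne_zero.2 hD) ?_
    rw [Matrix.det_fin_two, hP00, zero_mul, zero_sub] at hPdet
    rw [map_neg, ← hPdet]
    ring
  obtain ⟨π, hπ, hPπ⟩ := hP10
  -- determinant data of letters and prefixes
  choose dA hdA hAdA using hAdet
  have hpre : ∀ t : ℕ, ∃ dU : ℂ, dU ≠ 0 ∧ (As.take t).prod.det = MvPolynomial.C dU := fun t =>
    oneWalk_det_list_prod (As.take t) (fun A hA => ⟨dA A (List.mem_of_mem_take hA),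
      hdA A _, hAdA A _⟩)
  choose dU hdU hUdU using hpre
  -- the constants
  refine ⟨Bs, fun t => if ht : t < As.length then
      (dU t * dA (As[t]) (List.getElem_mem ht))⁻¹ * π else 1, hBlen, hBS, ?_, ?_⟩
  · intro t ht
    have htA : t < As.length := by omega
    dsimp only
    rw [dif_pos htA]
    exact mul_ne_zero (inv_ne_zero (mul_ne_zero (hdU t) (hdA _ _))) hπ
  · rw [hf, Matrix.sum_apply]
    refine Finset.sum_congr rfl fun t ht => ?_
    rw [Finset.mem_range] at ht
    have htA : t < As.length := by omega
    dsimp only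
    rw [dif_pos htA]
    have hgetD : As.getD t 0 = As[t] := by
      rw [List.getD_eq_getElem?_getD, List.getElem?_eq_getElem htA, Option.getD_some]
    have hsplit : (As.take t).prod * As[t] * (As.drop (t + 1)).prod = As.prod :=
      oneWalk_split As t htA
    rw [hgetD, oneWalk_sandwich _ _ _ _ (Bs.getD t 0) hsplit (dU t)
      (dA (As[t]) (List.getElem_mem htA)) (hUdU t) (hAdA _ _) (hdU t) (hdA _ _) hP00, hPπ,
      map_mul]

end Summit.ValiantsHypothesis.ValiantsHypothesis.Cruxes.WordLengthQP.EpsOrderLadder
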